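import Summits.ResolutionOfSingularities.ResolutionOfSingularities.Theorems.MarkedTransferCampaignW46MohWindowShadePhase
import Mathlib.RingTheory.MvPowerSeries.NoZeroDivisors
import HarnessLib

/-!
# [OURS · L1 W4.6] Rung (iii) "Moh window", SURFACES — from the digit phase to an honest FORMAL POWER SERIES
  factorisation `F = h^p · W` in `K[[y_j, y_i]]`

Cell `res-hironaka`, rung L, slot W4.6, seat `res-L1-s46-pv-6` (gen 3).  The termination theorems of the seat
(`…StallWalk`, `…Termination`, `…Phase`) conclude that some state of an infinite in-window walk is a `p`-th power of a
smooth curve times a cofactor TO EVERY ORDER, with COHERENT digits (`…Phase.formal_branch_of_walk`: the truncations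
`ψ_k = Σ_{k'<k} t_{k'} y_j^{k'+1}` of one sequence of digits).  This file passes to the limit:

* `le_ordZero_sub_cofactor` — cofactors stabilise: if `F ≡ h^p·w ≡ h'^p·w'` modulo degree `≥ N` with `ord h = 1` and
  `ord(h − h') ≥ M`, then `ord(w − w') ≥ min(pM, N) − p` (characteristic `p`: `h'^p − h^p = (h' − h)^p`; the order of a
  product is the sum of the orders);
* `exists_powerSeries_factor` — if `F ≡ (y_i − ψ_k(y_j))^p · w_k` modulo degree `≥ o + k` for EVERY `k` (`p < o`), then in
  the formal power series ring `F = (y_i − ψ(y_j))^p · W` ON THE NOSE, with `ψ = Σ_k t_k y_j^{k+1} ∈ K[[y_j]]` and `W`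
  the coefficientwise limit of the `w_k`;
* `exists_formal_pfold_curve_of_walk` — THE TERMINATION THEOREM IN ITS FINAL FORM: along every infinite walk of
  equimultiple point blow-ups of `x^p + F(y_j, y_i)` presented in the Hauser–Wagner frame and staying in the window,
  some residual polynomial `F_n` is DIVISIBLE IN `K[[y_j, y_i]]` BY THE `p`-TH POWER OF A SMOOTH FORMAL CURVE GERM
  `h` (`h(0) = 0`, `dh(0) ≠ 0`): `F_n = h^p · W` — a formal curve of `p`-fold points of `x^p + F_n` through the point.
OURS; replaces — for regime (iii) of RESCUE-SEED W4.6, the classical pair, surfaces — the ROLE of the termination clause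
of Th. 16.13 (ms. p. 87 l. 25–29); NOT a statement of the manuscript [claim: Hironaka2017, status: under-review],
nothing of which is used.  AI review is weaker than expert review.
-/

noncomputable section

set_option linter.dupNamespace false -- mandated namespace of this single-conjunct summit

open MvPolynomial Finset

namespace Summit.ResolutionOfSingularities.ResolutionOfSingularities.Theorems.CampaignW46.MohWindowShadeFormalBranch

open Literature.AlgebraicGeometry.Resolution
open Literature.AlgebraicGeometry.Resolution.PointBlowup
open Literature.AlgebraicGeometry.Resolution.Hauser2010
open Literature.Barriers.ResolutionOfSingularities (ordZero_le_of_coeff_ne_zero le_ordZero_of_forall)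
open MohWindowShadeCleaning (eq_single_add_single degree_eq_add)

variable {σ : Type*} {K : Type*} [Field K] [Fintype σ] [DecidableEq σ] [DecidableEq K]
variable (p : ℕ) [hp : Fact p.Prime] [CharP K p]

/-! ## §1. Orders -/

omit [Fintype σ] [DecidableEq σ] [DecidableEq K] hp [CharP K p] in
/-- The order of a product is the sum of the orders (polynomials over a field). [folklore] -/
theorem ordZero_mul (A B : MvPolynomial σ K) : ordZero (A * B) = ordZero A + ordZero B := by
  unfold ordZero
  rw [MvPolynomial.coe_mul, MvPowerSeries.order_mul]

omit [Fintype σ] [DecidableEq σ] [DecidableEq K] hp [CharP K p] in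
/-- The order of a power. [folklore] -/
theorem ordZero_pow (A : MvPolynomial σ K) (n : ℕ) : ordZero (A ^ n) = n * ordZero A := by
  classical
  induction n with
  | zero =>
    rw [pow_zero, Nat.cast_zero, zero_mul, show (0 : ℕ∞) = ((0 : ℕ) : ℕ∞) by rfl, ordZero_eq_nat_iff]
    refine ⟨⟨0, ?_, by simp⟩, fun d hd => absurd hd (Nat.not_lt_zero _)⟩
    rw [MvPolynomial.coeff_one, if_pos rfl]; exact one_ne_zero
  | succ n ih => rw [pow_succ, ordZero_mul, ih, Nat.cast_succ, add_mul, one_mul]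

omit [Fintype σ] [DecidableEq σ] [DecidableEq K] hp [CharP K p] in
/-- Coefficients below the order vanish. [folklore] -/
theorem coeff_eq_zero_of_degree_lt {A : MvPolynomial σ K} {n : ℕ} (h : (n : ℕ∞) ≤ ordZero A) {d : σ →₀ ℕ}
    (hd : d.degree < n) : coeff d A = 0 := by
  by_contra hne
  have h1 := ordZero_le_of_coeff_ne_zero A d hne
  have h2 : (n : ℕ∞) ≤ d.degree := le_trans h h1
  have : n ≤ d.degree := by exact_mod_cast h2
  omega

omit [Fintype σ] [DecidableEq σ] [DecidableEq K] hp [CharP K p] in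
/-- The order of a sum is at least the lesser order. [folklore] -/
theorem le_ordZero_add {A B : MvPolynomial σ K} {n : ℕ} (hA : (n : ℕ∞) ≤ ordZero A) (hB : (n : ℕ∞) ≤ ordZero B) :
    (n : ℕ∞) ≤ ordZero (A + B) := by
  refine le_ordZero_of_forall _ _ fun d hd => ?_
  by_contra hlt
  push Not at hlt
  rw [coeff_add, coeff_eq_zero_of_degree_lt hA hlt, coeff_eq_zero_of_degree_lt hB hlt, add_zero] at hd
  exact hd rfl

omit [Fintype σ] [DecidableEq σ] [DecidableEq K] hp [CharP K p] in
/-- The order of a negative. [folklore] -/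
theorem ordZero_neg (A : MvPolynomial σ K) : ordZero (-A) = ordZero A := by
  unfold ordZero
  rw [← coeToMvPowerSeries.ringHom_apply, map_neg, MvPowerSeries.order_neg, coeToMvPowerSeries.ringHom_apply]

/-! ## §2. Stabilisation of the cofactors -/

omit [Fintype σ] [DecidableEq σ] [DecidableEq K] in
/-- **[OURS · L1 W4.6] Cofactors stabilise.**  If `F ≡ h^p·w` and `F ≡ h'^p·w'` modulo degree `≥ N`, with `ord h = 1`
and `ord(h − h') ≥ M`, then `ord(w − w') ≥ min(p·M, N) − p`: in characteristic `p`,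
`h^p·(w − w') = (F − h'^p w') − (F − h^p w) − (h − h')^p·w'`.  NOT a statement of the manuscript. [folklore] -/
theorem le_ordZero_sub_cofactor {F h h' w w' : MvPolynomial σ K} (hh : ordZero h = 1) {N M : ℕ}
    (hF : (N : ℕ∞) ≤ ordZero (F - h ^ p * w)) (hF' : (N : ℕ∞) ≤ ordZero (F - h' ^ p * w'))
    (hδ : (M : ℕ∞) ≤ ordZero (h - h')) :
    ((min (p * M) N - p : ℕ) : ℕ∞) ≤ ordZero (w - w') := by
  set L := min (p * M) N with hL
  -- the identity
  have hid : h ^ p * (w - w') = (F - h' ^ p * w') + -(F - h ^ p * w) + -((h - h') ^ p * w') := by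
    rw [sub_pow_char h h']
    ring
  have h1 : (L : ℕ∞) ≤ ordZero (h ^ p * (w - w')) := by
    rw [hid]
    refine le_ordZero_add (le_ordZero_add ?_ ?_) ?_
    · exact le_trans (by exact_mod_cast min_le_right _ _) hF'
    · rw [ordZero_neg]; exact le_trans (by exact_mod_cast min_le_right _ _) hF
    · rw [ordZero_neg, ordZero_mul, ordZero_pow]
      calc ((L : ℕ) : ℕ∞) ≤ ((p * M : ℕ) : ℕ∞) := by exact_mod_cast min_le_left _ _
        _ = (p : ℕ∞) * (M : ℕ∞) := by push_cast; rfl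
        _ ≤ (p : ℕ∞) * ordZero (h - h') := mul_le_mul_right hδ _
        _ ≤ (p : ℕ∞) * ordZero (h - h') + ordZero w' := le_self_add
  rw [ordZero_mul, ordZero_pow, hh, mul_one] at h1
  -- `L ≤ p + ord(w − w')`
  by_cases htop : ordZero (w - w') = ⊤
  · rw [htop]; exact le_top
  · obtain ⟨x, hx⟩ := ENat.ne_top_iff_exists.mp htop
    rw [← hx] at h1 ⊢
    have h2 : L ≤ p + x := by exact_mod_cast h1
    exact_mod_cast (by omega : L - p ≤ x)

/-! ## §3. The limit: a formal power series factorisation -/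

section TwoLetters

/-- The DIGIT SERIES `Σ_k t_k · y_j^{k+1} ∈ K[[y_j]] ⊂ K[[y]]` of a sequence of digits `t` (two letters `j ≠ i`: the
coefficient of `y^e` is `t_{e_j − 1}` when `e_i = 0`, `e_j ≥ 1`, and `0` otherwise) — the formal branch `y_i = ψ(y_j)`
followed by a digit phase. [folklore] -/
def digitSeries (j i : σ) (t : ℕ → K) : MvPowerSeries σ K :=
  fun e => if e i = 0 ∧ 1 ≤ e j then t (e j - 1) else 0

variable {j i : σ}

omit [Fintype σ] [DecidableEq σ] [DecidableEq K] hp [CharP K p] in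
/-- Coefficients of the digit series. [folklore] -/
theorem coeff_digitSeries (t : ℕ → K) (e : σ →₀ ℕ) :
    MvPowerSeries.coeff e (digitSeries j i t) = if e i = 0 ∧ 1 ≤ e j then t (e j - 1) else 0 := rfl

omit [Fintype σ] [DecidableEq K] hp [CharP K p] in
/-- The digit polynomials `ψ_k = Σ_{k'<k} t_{k'} y_j^{k'+1}` and `ψ_{k'}` (`k ≤ k'`) agree below degree `k + 1`. [folklore] -/
theorem le_ordZero_digits_sub (t : ℕ → K) {k k' : ℕ} (hkk' : k ≤ k') :
    ((k + 1 : ℕ) : ℕ∞) ≤ ordZero ((X i - ∑ n ∈ Finset.range k, C (t n) * X j ^ (n + 1)) -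
      (X i - ∑ n ∈ Finset.range k', C (t n) * X j ^ (n + 1)) : MvPolynomial σ K) := by
  classical
  have hsplit : (X i - ∑ n ∈ Finset.range k, C (t n) * X j ^ (n + 1)) -
      (X i - ∑ n ∈ Finset.range k', C (t n) * X j ^ (n + 1))
      = ∑ n ∈ Finset.Ico k k', (C (t n) * X j ^ (n + 1) : MvPolynomial σ K) := by
    rw [← Finset.sum_range_add_sum_Ico _ hkk']
    ring
  rw [hsplit]
  refine le_ordZero_of_forall _ _ fun d hd => ?_
  rw [coeff_sum] at hd
  obtain ⟨n, hn, hne⟩ := Finset.exists_ne_zero_of_sum_ne_zero hd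
  rw [coeff_C_mul, coeff_X_pow] at hne
  split_ifs at hne with h
  · rw [← h, Finsupp.degree_single]
    have := (Finset.mem_Ico.mp hn).1
    omega
  · exact absurd (mul_zero _) hne

omit [Fintype σ] [DecidableEq K] hp [CharP K p] in
/-- `ord(y_i − ψ_k) = 1`. [folklore] -/
theorem ordZero_X_sub_digits (hij : i ≠ j) (t : ℕ → K) (k : ℕ) :
    ordZero (X i - ∑ n ∈ Finset.range k, C (t n) * X j ^ (n + 1) : MvPolynomial σ K) = 1 := by
  rw [show (1 : ℕ∞) = ((1 : ℕ) : ℕ∞) by rfl, ordZero_eq_nat_iff]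
  refine ⟨⟨Finsupp.single i 1, ?_, Finsupp.degree_single _ _⟩, fun d hd => ?_⟩
  · rw [coeff_sub, coeff_X, if_pos rfl, MohWindowShadeDigits.coeff_single_digits hij, sub_zero]
    exact one_ne_zero
  · have hd0 : d = 0 := (Finsupp.degree_eq_zero_iff d).mp (by omega)
    rw [hd0, coeff_sub, coeff_X, if_neg (Finsupp.single_ne_zero.mpr one_ne_zero),
      MohWindowShadeDigits.coeff_zero_digits, sub_zero]

omit [DecidableEq K] hp [CharP K p] in
/-- Products of power series that agree below degree `N` agree below degree `N`. [folklore] -/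
theorem coeff_mul_eq_of_forall {A A' B B' : MvPowerSeries σ K} {N : ℕ}
    (hA : ∀ a : σ →₀ ℕ, a.degree ≤ N → MvPowerSeries.coeff a A = MvPowerSeries.coeff a A')
    (hB : ∀ a : σ →₀ ℕ, a.degree ≤ N → MvPowerSeries.coeff a B = MvPowerSeries.coeff a B')
    {e : σ →₀ ℕ} (he : e.degree ≤ N) :
    MvPowerSeries.coeff e (A * B) = MvPowerSeries.coeff e (A' * B') := by
  classical
  rw [MvPowerSeries.coeff_mul, MvPowerSeries.coeff_mul]
  refine Finset.sum_congr rfl fun x hx => ?_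
  rw [Finset.mem_antidiagonal] at hx
  have h1 : x.1.degree ≤ N := by
    have := degree_le_degree_of_le (show x.1 ≤ e from hx ▸ le_add_right le_rfl); omega
  have h2 : x.2.degree ≤ N := by
    have := degree_le_degree_of_le (show x.2 ≤ e from hx ▸ le_add_left le_rfl); omega
  rw [hA x.1 h1, hB x.2 h2]

omit [DecidableEq K] hp [CharP K p] in
/-- Powers of power series that agree below degree `N` agree below degree `N`. [folklore] -/
theorem coeff_pow_eq_of_forall {A A' : MvPowerSeries σ K} {N : ℕ}
    (hA : ∀ a : σ →₀ ℕ, a.degree ≤ N → MvPowerSeries.coeff a A = MvPowerSeries.coeff a A') (n : ℕ) :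
    ∀ e : σ →₀ ℕ, e.degree ≤ N → MvPowerSeries.coeff e (A ^ n) = MvPowerSeries.coeff e (A' ^ n) := by
  induction n with
  | zero => intro e _; rw [pow_zero, pow_zero]
  | succ n ih => intro e he; rw [pow_succ, pow_succ]; exact coeff_mul_eq_of_forall ih hA he

omit [DecidableEq K] in
/-- **[OURS · L1 W4.6] THE LIMIT: an honest factorisation in `K[[y_j, y_i]]`.**  Two letters `σ = {j, i}`, `p < o`.
If a polynomial `F` satisfies, for EVERY `k`, `ord(F − (y_i − ψ_k(y_j))^p · w_k) ≥ o + k` for some polynomial `w_k`,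
where `ψ_k = Σ_{k'<k} t_{k'} y_j^{k'+1}` are the truncations of the digit series `ψ = Σ_k t_k y_j^{k+1}`, then in the
formal power series ring `F = (y_i − ψ(y_j))^p · W` for a power series `W` (the coefficientwise limit of the `w_k`, which
stabilise by `le_ordZero_sub_cofactor`).  NOT a statement of the manuscript. [folklore] -/
theorem exists_powerSeries_factor (hij : i ≠ j) (htwo : ∀ l, l = j ∨ l = i) {F : MvPolynomial σ K} (t : ℕ → K)
    {o : ℕ} (hpo : p < o)
    (hk : ∀ k, ∃ w : MvPolynomial σ K, ((o + k : ℕ) : ℕ∞) ≤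
      ordZero (F - (X i - ∑ k' ∈ Finset.range k, C (t k') * X j ^ (k' + 1)) ^ p * w)) :
    ∃ W : MvPowerSeries σ K, (F : MvPowerSeries σ K) = (MvPowerSeries.X i - digitSeries j i t) ^ p * W := by
  classical
  choose w hw using hk
  set ψ : ℕ → MvPolynomial σ K := fun k => ∑ k' ∈ Finset.range k, C (t k') * X j ^ (k' + 1) with hψ
  -- stabilisation: the coefficients of degree `≤ k` of `w k` and `w k'` agree (`1 ≤ k ≤ k'`)
  have hstab : ∀ k k', 1 ≤ k → k ≤ k' → ∀ e : σ →₀ ℕ, e.degree ≤ k → coeff e (w k) = coeff e (w k') := by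
    intro k k' hk1 hkk' e he
    have h1 := le_ordZero_sub_cofactor p (ordZero_X_sub_digits hij t k) (hw k)
      (le_trans (by exact_mod_cast (by omega : o + k ≤ o + k')) (hw k')) (le_ordZero_digits_sub t hkk')
    -- `min (p (k+1)) (o + k) − p ≥ k + 1`
    have hp2 : 2 ≤ p := hp.out.two_le
    have hmin : k + 1 ≤ min (p * (k + 1)) (o + k) - p := by
      have : p * (k + 1) = p * k + p := by ring
      have : 2 * k ≤ p * k := Nat.mul_le_mul_right k hp2
      omega
    have h2 : ((k + 1 : ℕ) : ℕ∞) ≤ ordZero (w k - w k') := le_trans (by exact_mod_cast hmin) h1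
    have h3 := coeff_eq_zero_of_degree_lt h2 (d := e) (by omega)
    rw [coeff_sub, sub_eq_zero] at h3
    exact h3
  refine ⟨fun e => coeff e (w (e.degree + 1)), ?_⟩
  ext e
  set N := e.degree with hN
  set k := N + 1 with hkdef
  -- left: `coeff e F = coeff e (h_k^p w_k)`
  have hL : MvPowerSeries.coeff e (F : MvPowerSeries σ K) = coeff e ((X i - ψ k) ^ p * w k) := by
    rw [MvPolynomial.coeff_coe]
    have := coeff_eq_zero_of_degree_lt (hw k) (d := e) (by omega)
    rw [coeff_sub, sub_eq_zero] at this
    exact this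
  rw [hL, ← MvPolynomial.coeff_coe, MvPolynomial.coe_mul, MvPolynomial.coe_pow]
  symm
  refine coeff_mul_eq_of_forall (N := N) (coeff_pow_eq_of_forall (N := N) (fun a ha => ?_) p) (fun a ha => ?_) le_rfl
  · -- `H` and `h_k` agree below degree `N`
    rw [map_sub, MvPowerSeries.coeff_X, coeff_digitSeries, ← coeToMvPowerSeries.ringHom_apply, map_sub,
      coeToMvPowerSeries.ringHom_apply, coeToMvPowerSeries.ringHom_apply, map_sub, MvPolynomial.coeff_coe,
      MvPolynomial.coeff_coe, coeff_X, hψ]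
    simp only
    rw [coeff_sum]
    congr 1
    · by_cases h : a = Finsupp.single i 1
      · rw [if_pos h, if_pos h.symm]
      · rw [if_neg h, if_neg (Ne.symm h)]
    · by_cases hc : a i = 0 ∧ 1 ≤ a j
      · rw [if_pos hc]
        have ha' : Finsupp.single j (a j - 1 + 1) = a := by
          rw [Nat.sub_add_cancel hc.2]
          conv_rhs => rw [eq_single_add_single hij htwo a, hc.1, Finsupp.single_zero, add_zero]
        rw [Finset.sum_eq_single (a j - 1)]
        · rw [coeff_C_mul, coeff_X_pow, if_pos ha', mul_one]
        · intro n _ hn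
          rw [coeff_C_mul, coeff_X_pow, if_neg, mul_zero]
          intro h
          apply hn
          have := DFunLike.congr_fun h j
          rw [Finsupp.single_eq_same] at this
          omega
        · intro hn
          exfalso
          rw [Finset.mem_range, not_lt] at hn
          rw [degree_eq_add hij htwo a] at ha
          omega
      · rw [if_neg hc]
        symm
        refine Finset.sum_eq_zero fun n hn => ?_
        rw [coeff_C_mul, coeff_X_pow, if_neg, mul_zero]
        intro h
        apply hc
        rw [← h, Finsupp.single_eq_of_ne hij, Finsupp.single_eq_same]
        exact ⟨rfl, by omega⟩
  · -- `W` and `w_k` agree below degree `N`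
    rw [MvPowerSeries.coeff_apply, MvPolynomial.coeff_coe]
    exact hstab (a.degree + 1) k (by omega) (by omega) a (by omega)

/-- **[OURS · L1 W4.6] RUNG (iii), SURFACES — TERMINATION, FINAL FORM: every infinite in-window walk meets a FORMAL
CURVE OF `p`-FOLD POINTS.**  Let `s₀, s₁, …` be an infinite walk of point blow-ups of `x^p + F(y_j, y_i)` presented in
the Hauser–Wagner frame (chart `c n ∈ {j, i}`, `b n (c n) = 0`, `b n = 0` when `c n = i`), from a cleaned state with
`y^r ∣ F`, every step equimultiple, every state inside the window `p ≤ ord F_n < 2p`.  Then for some `n` the residual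
polynomial `F_n` is DIVISIBLE, in the formal power series ring `K[[y_j, y_i]]`, by the `p`-th power of a SMOOTH formal
curve germ: `F_n = h^p · W` with `h(0) = 0` and some `∂h/∂y_l(0) ≠ 0` — so `x^p + F_n = (x + …)`… has the formal curve
`{h = 0}` of `p`-fold points through the point (`h` is a coordinate `y_l`, or the branch `y_i − Σ_k t_{n+k} y_j^{k+1}`
whose digits are the later points of the walk).  Contrapositive: off formal `p`-fold curves (e.g. isolated `p`-fold
points at every stage) every such walk is FINITE; the exclusion is necessary (gen 2 `…Cycle`, `…FixedPoint`,
`…NoInvariant`).  Replaces, for regime (iii) of RESCUE-SEED W4.6, the classical pair, surfaces, the ROLE of the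
termination clause of Th. 16.13 (ms. p. 87 l. 25–29); NOT a statement of the manuscript. [folklore] -/
theorem exists_formal_pfold_curve_of_walk (hij : i ≠ j) (htwo : ∀ l, l = j ∨ l = i) (s : ℕ → State σ K)
    (c : ℕ → σ) (b : ℕ → σ → K) (hb : ∀ n, b n (c n) = 0) (hHW : ∀ n, c n = i → ∀ l, b n l = 0)
    (hstep : ∀ n, s (n + 1) = step p (c n) (b n) (s n))
    (hclean : deletePthPowers p (s 0).F = (s 0).F) (hr : ∀ d ∈ (s 0).F.support, (s 0).r ≤ d)
    (heq : ∀ n, IsEquimultiplePoint p (c n) (b n) (s n))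
    (hwin : ∀ n, (p : ℕ∞) ≤ ordZero (s n).F ∧ ordZero (s n).F < (2 * p : ℕ)) :
    ∃ (n : ℕ) (h W : MvPowerSeries σ K), MvPowerSeries.constantCoeff h = 0 ∧
      (∃ l, MvPowerSeries.coeff (Finsupp.single l 1) h ≠ 0) ∧ ((s n).F : MvPowerSeries σ K) = h ^ p * W := by
  classical
  obtain ⟨n, hn⟩ := MohWindowShadePhase.formal_branch_of_walk p hij htwo s c b hb hHW hstep hclean hr heq hwin
  rcases hn with ⟨l, hl⟩ | hbranch
  · -- a coordinate `p`-th power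
    obtain ⟨h, w, hh0, ⟨l', hl'⟩, hord⟩ :=
      MohWindowShadeStallWalk.exists_formal_curve_of_forall_le p hl 0
    -- `exists_formal_curve_of_forall_le` returns `h = y_l` with `F = y_l^p · w` exactly; re-derive the exact form
    refine ⟨n, (X l : MvPolynomial σ K), (∑ d ∈ (s n).F.support, monomial (d - Finsupp.single l p) (coeff d (s n).F) :
      MvPolynomial σ K), ?_, ⟨l, ?_⟩, ?_⟩
    · rw [MvPolynomial.coe_X, MvPowerSeries.constantCoeff_X]
    · rw [MvPolynomial.coe_X, MvPowerSeries.coeff_index_single_self_X]; exact one_ne_zero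
    · rw [← MvPolynomial.coe_pow, ← MvPolynomial.coe_mul]
      congr 1
      rw [Finset.mul_sum]
      have h1 : ∀ d ∈ (s n).F.support,
          X l ^ p * monomial (d - Finsupp.single l p) (coeff d (s n).F) = monomial d (coeff d (s n).F) := by
        intro d hd
        rw [← monomial_single_add, add_tsub_cancel_of_le (Finsupp.single_le_iff.mpr (hl d hd))]
      rw [Finset.sum_congr rfl h1]
      exact (s n).F.as_sum
  · -- a digit phase: the limit factorisation
    have hinv := MohWindowShadeStallWalk.invariants_of_walk p hij htwo s c b hb hstep hclean hr heq hwin n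
    obtain ⟨o, ho, hlo, -⟩ := hinv.2.2
    have hk : ∀ k, ∃ w : MvPolynomial σ K, ((o + k : ℕ) : ℕ∞) ≤ ordZero ((s n).F -
        (X i - ∑ k' ∈ Finset.range k, C (b (n + k') i) * X j ^ (k' + 1)) ^ p * w) := by
      intro k
      obtain ⟨w, hw⟩ := hbranch k
      exact ⟨w, by rw [ho] at hw; exact_mod_cast hw⟩
    obtain ⟨W, hW⟩ := exists_powerSeries_factor p hij htwo (fun k' => b (n + k') i) hlo hk
    refine ⟨n, MvPowerSeries.X i - digitSeries j i (fun k' => b (n + k') i), W, ?_, ⟨i, ?_⟩, hW⟩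
    · rw [map_sub, MvPowerSeries.constantCoeff_X, zero_sub, neg_eq_zero, ← MvPowerSeries.coeff_zero_eq_constantCoeff,
        coeff_digitSeries, if_neg]
      simp
    · rw [map_sub, MvPowerSeries.coeff_index_single_self_X, coeff_digitSeries, if_neg]
      · simp
      · rw [Finsupp.single_eq_same]; omega

/-! ## v2 (APPEND-ONLY): the SHAPE of the formal curve — a coordinate letter or the digit branch -/

/-- **[OURS · L1 W4.6] The formal `p`-fold curve met by an infinite in-window walk is EITHER a coordinate axis OR the
digit branch** (refinement of `exists_formal_pfold_curve_of_walk` for the scheme transport, rung (iii-2) piece (H2)):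
under the same hypotheses, at some stage `n` either `↑F_n = y_l^p · W` for a letter `l` (the exceptional/coordinate curve
`y_l = 0` is `p`-fold), or `↑F_n = (y_i − ψ(y_j))^p · W` with `ψ = digitSeries j i t` the digit series of the LATER
POINTS OF THE WALK, `t k = b (n + k) i` (the branch `y_i = Σ_k t_k y_j^{k+1}`, transversal to the exceptional line
`y_j = 0`).  NOT a statement of the manuscript. [folklore] -/
theorem exists_coordinate_or_digit_curve_of_walk (hij : i ≠ j) (htwo : ∀ l, l = j ∨ l = i) (s : ℕ → State σ K)
    (c : ℕ → σ) (b : ℕ → σ → K) (hb : ∀ n, b n (c n) = 0) (hHW : ∀ n, c n = i → ∀ l, b n l = 0)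
    (hstep : ∀ n, s (n + 1) = step p (c n) (b n) (s n))
    (hclean : deletePthPowers p (s 0).F = (s 0).F) (hr : ∀ d ∈ (s 0).F.support, (s 0).r ≤ d)
    (heq : ∀ n, IsEquimultiplePoint p (c n) (b n) (s n))
    (hwin : ∀ n, (p : ℕ∞) ≤ ordZero (s n).F ∧ ordZero (s n).F < (2 * p : ℕ)) :
    ∃ n, (∃ (l : σ) (W : MvPolynomial σ K), (s n).F = X l ^ p * W) ∨
      ∃ W : MvPowerSeries σ K, ((s n).F : MvPowerSeries σ K) =
        (MvPowerSeries.X i - digitSeries j i (fun k => b (n + k) i)) ^ p * W := by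
  classical
  obtain ⟨n, hn⟩ := MohWindowShadePhase.formal_branch_of_walk p hij htwo s c b hb hHW hstep hclean hr heq hwin
  refine ⟨n, ?_⟩
  rcases hn with ⟨l, hl⟩ | hbranch
  · refine Or.inl ⟨l, ∑ d ∈ (s n).F.support, monomial (d - Finsupp.single l p) (coeff d (s n).F), ?_⟩
    rw [Finset.mul_sum]
    have h1 : ∀ d ∈ (s n).F.support,
        X l ^ p * monomial (d - Finsupp.single l p) (coeff d (s n).F) = monomial d (coeff d (s n).F) := by
      intro d hd
      rw [← monomial_single_add, add_tsub_cancel_of_le (Finsupp.single_le_iff.mpr (hl d hd))]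
    rw [Finset.sum_congr rfl h1]
    exact (s n).F.as_sum
  · right
    have hinv := MohWindowShadeStallWalk.invariants_of_walk p hij htwo s c b hb hstep hclean hr heq hwin n
    obtain ⟨o, ho, hlo, -⟩ := hinv.2.2
    have hk : ∀ k, ∃ w : MvPolynomial σ K, ((o + k : ℕ) : ℕ∞) ≤ ordZero ((s n).F -
        (X i - ∑ k' ∈ Finset.range k, C (b (n + k') i) * X j ^ (k' + 1)) ^ p * w) := by
      intro k
      obtain ⟨w, hw⟩ := hbranch k
      exact ⟨w, by rw [ho] at hw; exact_mod_cast hw⟩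
    exact exists_powerSeries_factor p hij htwo (fun k' => b (n + k') i) hlo hk

end TwoLetters

end Summit.ResolutionOfSingularities.ResolutionOfSingularities.Theorems.CampaignW46.MohWindowShadeFormalBranch
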